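import Summits.Langlands.Langlands.Theses.IrreducibilityBySelfDuality
import Summits.Langlands.Langlands.Theorems.RegularTwistCM.Negative.ArchShadow
import Summits.Langlands.Langlands.Theorems.RegularTwistCM.Negative.ArchShadowParity
import Literature.NumberTheory.Automorphic.AutomorphicRepsGLOneArchParameter
import Literature.NumberTheory.Automorphic.KimExteriorSquareGL4ArchimedeanTwist
import Literature.NumberTheory.Automorphic.HermitianArchParameter
import Literature.NumberTheory.Automorphic.StrongMultiplicityOneRepData
import Literature.NumberTheory.Automorphic.ClozelAlgebraicityCMAssemblyProofs
import Literature.NumberTheory.Automorphic.LanglandsTetrahedral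

/-!
# Line `petersson-hermitian-purity` — LEAD'S WORKING SKELETON for the crux
`Summit.Langlands.Langlands.Theses.IrreducibilityBySelfDuality.RegularTwistCM` (stmt-Langlands-14069)

Lead prover-line-stmt-Langlands-14069-0, 2026-08-16 (from the planner's checked skeleton
`Cruxes/RegularTwistCM/Lines/petersson-hermitian-purity.lean` @fa5252dfcb52). RESHAPE r1 (lead):
(a) every `stub_*` now carries its signature INLINED (self-contained over tree declarations, so a worker's
`Theorems/…` helper restates it verbatim and `--supports` matches it textually); (b) the planner's single
`stub_adjointArchShadow` is cut at the skeleton level into TWO registered stubs with distinct printed sources —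
`stub_adjointArchShadowNonDihedral` (GJ 1978 Thm (9.3) at `∞` for NON-DIHEDRAL `σ₀` + JS II Thm 4.4 = tree SMO∞)
and `stub_dihedralVacuity` (GJ 1978 (3.7)/Remark (9.9) + JS II Thm 4.4: for an a.e. quadratic self-twist `σ₀`
NO cuspidal `π` carries `d · Ad(t_{σ₀})` a.e.) — the crux as filed quantifies over dihedral `σ₀` although its only
consumer (`RegularAdjointLiftCM`, fed by `SelfdualGL3AdjointLift`) always holds the non-dihedral clause; the
composition `RegularTwistCM_of_stubs` case-splits on `IsQuadraticSelfTwistAE`. Six stubs (≤ stubs_max = 7).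

Planner crux-plan, round 1 (idea card `Cruxes/RegularTwistCM/Ideas/petersson-hermitian-purity.md`; line card
`Cruxes/RegularTwistCM/Lines/petersson-hermitian-purity.md`; triage r1-1/r1-2/r1-3: pass ×3, merged with
`unitary-mirror-parity` — same lever). FIVE registered stubs `stub_*` (the only `sorry`s of the file) — all of them
printed INPUTS shared verbatim with the sibling lines — and the LEVER OF THE CARD PROVED IN FULL:

* `cleanInvariantMirror` (PROVED) — the Petersson–Hermitian mirror `P(ῑ) = {-z̄ : z ∈ P(ι)}` for every CLEAN,
  `A_G`-INVARIANT cuspidal Borel–Jacquet datum on `GL_n` (any `n ≥ 1`, any number field);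
* `unitaryMirrorReal` (PROVED) — the unitary mirror `P(ῑ) = {-z̄ + c : z ∈ P(ι)}`, ONE real `c`, for every cuspidal
  datum whose total archimedean exponent `∑_σ ∑ P(σ)` is real (e.g. every C- or L-algebraic one);
* `parity_of_mirror3` + `RegularTwistCM_of_stubs` Step 7 (PROVED) — applied to the REGULAR ALGEBRAIC `π` on `GL₃`
  (integral parameter, so real exponent), the mirror of the adjoint shape `{a + q, q, -a + q}` forces `b = ±a` at
  the conjugate embedding: the parity input (P) of Disproof F6, uniformly over the complex places, with NO Clozel
  purity fact, NO unitary dual of `GL₂(ℂ)` and NO complex-power twist.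

The kernel-checked composition, in two renderings:

  `RegularTwistCM_of_stubs : AdjointArchShadowNonDihedral → DihedralVacuity → DescentInfinityType →
     CentralCharacterDatum → HalfIntegralTwistCM → TwistRealisation → Crux`
  `RegularTwistCM_of : RegularTwistCM`   (the audited theorem: `_of_stubs` fed with the six `stub_*`)

(`Crux` is the route decl by `abbrev`; the binder form concludes it through the abbreviation so that the skeleton
audit, which admits no def-typed hypotheses, sees exactly one theorem concluding the crux BY NAME). The fourth
antecedent is the route's own item `HalfIntegralTwistCM` (stmt-Langlands-14036) BY NAME.

## How the lever is proved (the card's K2, "an M-sized assembly, not an import" — confirmed)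

`cleanInvariantMirror`: the Petersson pairing `⟪φ, ψ⟫_μ = ∫ φ̃ conj ψ̃ dμ` (`AdelicGroupData.l2Pairing`) for an
automorphic measure `μ` (`AdelicGroupData.exists_isAutomorphicMeasure_gl_holds`, Borel–Harish-Chandra) is defined on the
forms of `π` because `A_G`-invariant cusp forms are bounded (`AutomorphicRepsGL.cuspidal_bounded_holds`,
`le_bddInvariant_of_cuspidal_bounded`); transported to `W / W' = W / ⊥ ≅ W` (`Submodule.quotEquivOfEqBot`) it is
sesquilinear (`l2Pairing_add_left/right`, `l2Pairing_smul_left/right`), the Lie action carrying the parameter is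
differentiation of forms (`HasLieAction`) and 𝔤 acts skew-symmetrically (`AutomorphyDatum.l2Pairing_lieDeriv_add_eq_zero`,
Knapp–Vogan (0.5)), and `⟪φ, φ⟫ ≠ 0` for `φ ≠ 0` (`eq_zero_of_l2Pairing_self_eq_zero`, `W ≠ W' = ⊥`); so the
Lie-level theorem `HasArchParameter.map_neg_conj_of_skewHermitian` (HermitianArchParameter) applies.
`unitaryMirrorReal`: pass to a clean model with the same parameter
(`exists_clean_hasSatakeParamAt_hasArchParameter_of_sSup_irreducible` + `stable_cuspidal_eq_sSup_irreducible_holds`),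
on which `A_G` acts by `a ↦ a^μ`, `μ = ∑_σ ∑ P(σ)` (`HasArchParameter.apply_posRealScalar_mul_of_W'_eq_bot`), twist by
the REAL power `|det|^{r}`, `r = -μ/(n[K:ℚ])` (`exists_heckeCharacter_ideleNorm_cpow`,
`exists_cuspidalAutomorphicRepData_map_mulChar_detTwist`, `mulChar_detTwist_apply_posRealScalar_mul_of_cpow`; parameter
`P + r` by the tree's `HasArchParameter.of_map_mulChar_detTwist`, which is stated for real exponents — enough here),
apply `cleanInvariantMirror`, untwist: `c = -2r`.

For the record (attached to the crux item as evidence `general-mirror.lean`, not part of this skeleton): the mirror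
for ALL cuspidal data (`UnitaryMirror`, complex `μ`, e.g. `σ₀ = σ_alg ⊗ |det|^{iy}` of Disproof F4) follows from
`cleanInvariantMirror` and exactly one more tree lemma, `CpowDetTwistArch` — the archimedean parameter of a
COMPLEX-power determinant twist (triage r1-2's caveat) — by the same assembly (kernel-checked there); this line
sidesteps it by mirroring `π` (integral parameter) instead of `σ₀`.

## The stubs (inputs; shared verbatim with `unitary-mirror-parity`; stub 1 cut into 1a/1b by the lead)

* `stub_adjointArchShadow` — INPUT (Gelbart–Jacquet 1978 Thm (9.3) at the archimedean places + Jacquet–Shalika 1981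
  II Thm 4.4 on Harish-Chandra multisets; SMO∞ itself IS a tree theorem mod two named facts:
  `CuspidalAutomorphicRepData.hasArchParameter_eq_of_isNearlyEquivalent`). The hardest stub.
* `stub_descentInfinityType` — INPUT: `σ₀.1.exists_hasInfinityType` (Clozel §3.3, n = 2) = the INTEGRAL PAIRING
  `s_i ι - s_i ῑ ∈ ℤ`, independent of mirror + purity + integrality (triage r1-1 §A / r1-3 cross-cutting sharpen).
* `stub_centralCharacterDatum` — the central character of `σ₀` as a `GL(1)` datum with parameter `{∑ P(ι)}`
  (hypothesis (iv) of `HalfIntegralTwistCM`).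
* `stub_halfIntegralTwist` — route item `HalfIntegralTwistCM` by name (the GL(1)/CM lever: Weil on `U²` + Chevalley).
* `stub_twistRealisation` — arch-aware twist of a cuspidal `GL_n` datum by a `GL(1)` datum (Disproof F1's depth).

PROVED here (no sorry): `cleanInvariantMirror`, `unitaryMirrorReal_of`, `unitaryMirrorReal`, `parity_of_mirror3`,
`im_totalExponent_eq_zero_of_integral`, `exists_paired_exponents_of_hasInfinityType`; inside `RegularTwistCM_of_stubs`: ν's parameter, integrality /
regularity from `π` RA through the shadow, the parity (iii) and the other three hypotheses of `HalfIntegralTwistCM`,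
and the regular algebraic certificate of `σ = σ₀ ⊗ χ`.

DISPROOF USED (`Cruxes/RegularTwistCM/Disproof.lean` cycles 1–2; landed Negative lemmas imported above and no stub is
an instance they refute): `regularTwistCM_false_without_IsCMField` — `IsCMField` is consumed ONLY at
`stub_halfIntegralTwist`; `regularTwistCM_false_without_RegularAlgebraic` — regular algebraicity of `π` is consumed in
`RegularTwistCM_of_stubs` Steps 5–7 (integrality, `Nodup`, AND the reality of the total exponent that licenses the
mirror); F4/F8 (`not_RegularTwistCMAlgebraicTwist`, `not_RegularTwistCMGlobalPowerTwist`) avoided — `χ` is whatever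
`HalfIntegralTwistCM` returns, never algebraic/global-power; F2 `squares_trick_tight` lives inside
`HalfIntegralTwistCM`; F6 (P) is fed by the mirror of `π` (`parity_of_mirror3`: `b = ∓a`, sign irrelevant —
`cmParity_sufficient`).
-/

set_option linter.dupNamespace false
set_option linter.unusedVariables false

noncomputable section

-- (H5 of the tree's archimedean files: the place subtypes indexing `mixedSpace K` are `Fintype` classically)
open scoped ComplexConjugate Classical NNReal
open NumberField Filter
open NumberField.mixedEmbedding (mixedSpace)

namespace Summit.Langlands.Langlands.Cruxes.RegularTwistCM.PeterssonHermitianPurity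

open Literature.NumberTheory.Automorphic
open Literature.NumberTheory.GaloisRepresentations (HeckeCharacter ideleGroup)

-- Mathlib idiom (Mathlib/Algebra/Lie/OfAssociative.lean): the commutator bracket on matrices
attribute [local instance 100] LieRing.ofAssociativeRing

/-! ## The crux by name, and the statements of the stubs -/

/-- The crux under construction, by name (definitionally the route decl; used only as the conclusion of the
binder-form composition `RegularTwistCM_of_stubs` — the audited theorem `RegularTwistCM_of` states the route decl
literally). -/
abbrev Crux : Prop := Summit.Langlands.Langlands.Theses.IrreducibilityBySelfDuality.RegularTwistCM

/-- **Stub 1a statement — the adjoint archimedean shadow for NON-DIHEDRAL `σ₀` (INPUT: Gelbart–Jacquet 1978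
Thm (9.3) at `∞` + Jacquet–Shalika II Thm 4.4, on Harish-Chandra multisets).** For cuspidal `π` (GL₃), `σ₀` (GL₂),
`ν` (GL₁) over ANY number field, `σ₀` for NO quadratic `L/K` an a.e. self-twist by `ε_{L/K}`
(`IsQuadraticSelfTwistAE`, verbatim the hypothesis of the tree's `GelbartJacquet_adjoint_lift`), with
`t_π = d · Ad(t_{σ₀})` a.e. (the crux's hypothesis verbatim), and any archimedean parameters `χπ, χσ, χν` of the
three data: at every embedding `ι`, if `χσ ι = {x, y}` and `χν ι = {q}` then `χπ ι = {x - y + q, q, y - x + q}`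
(`π ≅ Ad(σ₀) ⊗ ν`, Gelbart–Jacquet's CUSPIDAL lift, by strong multiplicity one with archimedean components). -/
def AdjointArchShadowNonDihedral : Prop :=
  ∀ (K : Type) [Field K] [NumberField K]
    (h1 : isCompact_glFiniteIntegralLevel 1 K) (hcpt₂ : isCompact_glFiniteIntegralLevel 2 K)
    (hcpt : isCompact_glFiniteIntegralLevel 3 K)
    (π : CuspidalAutomorphicRepData 3 K hcpt) (σ₀ : CuspidalAutomorphicRepData 2 K hcpt₂)
    (ν : CuspidalAutomorphicRepData 1 K h1),
    (∀ (L : Type) [Field L] [NumberField L] [Algebra K L], Module.finrank K L = 2 →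
      ¬ IsQuadraticSelfTwistAE L σ₀.1) →
    (∀ᶠ v in cofinite, ∀ α β : Multiset ℂ, π.1.HasSatakeParamAt v α →
      σ₀.1.HasSatakeParamAt v β → ∃ d : ℂ, ν.1.HasSatakeParamAt v {d} ∧
        α = (((β ×ˢ β).map (fun r : ℂ × ℂ => r.1 * r.2⁻¹)).erase 1).map (fun e => d * e)) →
    ∀ (χπ χσ χν : (K →+* ℂ) → Multiset ℂ),
      π.1.HasArchParameter χπ → σ₀.1.HasArchParameter χσ → ν.1.HasArchParameter χν →
      ∀ (ι : K →+* ℂ) (x y q : ℂ), χσ ι = {x, y} → χν ι = {q} →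
        χπ ι = {x - y + q, q, y - x + q}

/-- **Stub 1b statement — the dihedral case is VACUOUS (INPUT: Gelbart–Jacquet 1978 (3.7) and Remark (9.9) —
the lift of a monomial `σ₀` is automorphic NON-cuspidal, an induced representation — + Jacquet–Shalika 1981 II
Thm 4.4 — a cuspidal representation of `GL₃` is not nearly equivalent to one induced from a proper Levi).** For
cuspidal `π` (GL₃), `σ₀` (GL₂), `ν` (GL₁) over ANY number field: if `σ₀` IS an a.e. self-twist by `ε_{L/K}` for
some quadratic `L/K`, then the crux's a.e. identity `t_π = d · Ad(t_{σ₀})` fails. (The crux as filed omits the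
non-dihedral clause that its consumer `RegularAdjointLiftCM` always has; this stub is the price.) -/
def DihedralVacuity : Prop :=
  ∀ (K : Type) [Field K] [NumberField K]
    (h1 : isCompact_glFiniteIntegralLevel 1 K) (hcpt₂ : isCompact_glFiniteIntegralLevel 2 K)
    (hcpt : isCompact_glFiniteIntegralLevel 3 K)
    (π : CuspidalAutomorphicRepData 3 K hcpt) (σ₀ : CuspidalAutomorphicRepData 2 K hcpt₂)
    (ν : CuspidalAutomorphicRepData 1 K h1)
    (L : Type) [Field L] [NumberField L] [Algebra K L], Module.finrank K L = 2 →
    IsQuadraticSelfTwistAE L σ₀.1 →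
    ¬ (∀ᶠ v in cofinite, ∀ α β : Multiset ℂ, π.1.HasSatakeParamAt v α →
      σ₀.1.HasSatakeParamAt v β → ∃ d : ℂ, ν.1.HasSatakeParamAt v {d} ∧
        α = (((β ×ˢ β).map (fun r : ℂ × ℂ => r.1 * r.2⁻¹)).erase 1).map (fun e => d * e))

/-- **Stub 2 statement — the descent datum has a well-formed infinity type (INPUT: Clozel 1990 §3.3 for
`n = 2`, = the tree's named fact `AutomorphicRepData.exists_hasInfinityType` on the instance `σ₀`).** This is
the INTEGRAL PAIRING of the Harish-Chandra parameter of `σ₀` (`s_i ι - s_i ῑ ∈ ℤ` for a suitable labelling),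
the archimedean input the triage panel proved independent of mirror/purity/integrality. Shared verbatim. -/
def DescentInfinityType : Prop :=
  ∀ (K : Type) [Field K] [NumberField K] (hcpt₂ : isCompact_glFiniteIntegralLevel 2 K)
    (σ₀ : CuspidalAutomorphicRepData 2 K hcpt₂), σ₀.1.exists_hasInfinityType

/-- **Stub 3 statement — the central character as a `GL(1)` datum, archimedean clause.** For a cuspidal
datum `π` on `GL_n(𝔸_K)` (`n ≥ 1`) with archimedean parameter `P` there is a cuspidal `GL(1)` datum `ω`
(the central character `ω_π`, a Hecke character) whose archimedean parameter at `ι` is `{∑ P(ι)}` (the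
central `1_w ∈ 𝔤𝔩_n(K_w)` acts at the embedding `ι` through `γ(E_ι) = ∑_i x_{ι,i}`). Shared verbatim. -/
def CentralCharacterDatum : Prop :=
  ∀ (n : ℕ) [NeZero n] (K : Type) [Field K] [NumberField K]
    (h1 : isCompact_glFiniteIntegralLevel 1 K) (hcpt : isCompact_glFiniteIntegralLevel n K)
    (π : CuspidalAutomorphicRepData n K hcpt) (P : (K →+* ℂ) → Multiset ℂ), π.1.HasArchParameter P →
      ∃ ω : CuspidalAutomorphicRepData 1 K h1, ω.1.HasArchParameter (fun ι => {(P ι).sum})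

/-! **Stub 4 statement** is the route item
`Summit.Langlands.Langlands.Theses.IrreducibilityBySelfDuality.HalfIntegralTwistCM` (stmt-Langlands-14036, crux r4)
BY NAME: the GL(1)/CM lever (Weil's unit criterion on `U²` + Chevalley 1951 Thm 1, `m = 2`); the only place
`IsCMField` is consumed (`Disproof.regularTwistCM_false_without_IsCMField` honoured there) and where
`squares_trick(_tight)` lives. -/

/-- **Stub 5 statement — twist of a cuspidal `GL_n` datum by a `GL(1)` datum, with its archimedean
parameter.** For cuspidal `π` on `GL_n(𝔸_K)` with archimedean parameter `P` and a cuspidal `GL(1)` datum `χ`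
with archimedean parameter `ι ↦ {p ι}`, there is a cuspidal datum `π' = π ⊗ χ` with archimedean parameter
`ι ↦ P(ι) + p ι` and, at almost every finite place, `t_{π'} = c_v · t_π` where `{c_v}` is the Satake parameter
of `χ`. (Satake half in tree for Hecke characters: `CuspidalAutomorphicRepData.exists_twist_hecke_hasSatakeParamAt`;
the archimedean half is the general-character analogue of `HasArchParameter.of_map_mulChar_detTwist`.) Shared verbatim. -/
def TwistRealisation : Prop :=
  ∀ (n : ℕ) [NeZero n] (K : Type) [Field K] [NumberField K]
    (h1 : isCompact_glFiniteIntegralLevel 1 K) (hcpt : isCompact_glFiniteIntegralLevel n K)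
    (π : CuspidalAutomorphicRepData n K hcpt) (χ : CuspidalAutomorphicRepData 1 K h1)
    (P : (K →+* ℂ) → Multiset ℂ) (p : (K →+* ℂ) → ℂ),
    π.1.HasArchParameter P → χ.1.HasArchParameter (fun ι => {p ι}) →
      ∃ π' : CuspidalAutomorphicRepData n K hcpt,
        π'.1.HasArchParameter (fun ι => (P ι).map (· + p ι)) ∧
        ∀ᶠ v in cofinite, ∀ β : Multiset ℂ, π.1.HasSatakeParamAt v β →
          ∃ c : ℂ, χ.1.HasSatakeParamAt v {c} ∧ π'.1.HasSatakeParamAt v (β.map (fun b => c * b))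

/-! ## The six registered stubs (the only `sorry`s of the line; signatures INLINED and self-contained — to restate
one verbatim in a `Theorems/…` helper: `open NumberField Filter` and `open Literature.NumberTheory.Automorphic`) -/

/-- **stub_adjointArchShadowNonDihedral** (= `AdjointArchShadowNonDihedral`) — INPUT [XL: Gelbart–Jacquet 1978 Thm
(9.3) at `∞` (to be vendored as a Literature named fact with its archimedean clause, in the style of
`Kim2003_exteriorSquare_GL4_archimedean`) + tree SMO∞ `CuspidalAutomorphicRepData.hasArchParameter_eq_of_isNearlyEquivalent`
(mod `hasSatakeParamAt_iff_L2`, `strong_multiplicity_one_gl_sphericalLevel`) + the twist `Ad(σ₀) ⊗ ν` (stub 5's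
mechanism) + `hasArchParameter_unique`]. Held by the lead. -/
theorem stub_adjointArchShadowNonDihedral :
    ∀ (K : Type) [Field K] [NumberField K]
      (h1 : isCompact_glFiniteIntegralLevel 1 K) (hcpt₂ : isCompact_glFiniteIntegralLevel 2 K)
      (hcpt : isCompact_glFiniteIntegralLevel 3 K)
      (π : CuspidalAutomorphicRepData 3 K hcpt) (σ₀ : CuspidalAutomorphicRepData 2 K hcpt₂)
      (ν : CuspidalAutomorphicRepData 1 K h1),
      (∀ (L : Type) [Field L] [NumberField L] [Algebra K L], Module.finrank K L = 2 →
        ¬ IsQuadraticSelfTwistAE L σ₀.1) →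
      (∀ᶠ v in cofinite, ∀ α β : Multiset ℂ, π.1.HasSatakeParamAt v α →
        σ₀.1.HasSatakeParamAt v β → ∃ d : ℂ, ν.1.HasSatakeParamAt v {d} ∧
          α = (((β ×ˢ β).map (fun r : ℂ × ℂ => r.1 * r.2⁻¹)).erase 1).map (fun e => d * e)) →
      ∀ (χπ χσ χν : (K →+* ℂ) → Multiset ℂ),
        π.1.HasArchParameter χπ → σ₀.1.HasArchParameter χσ → ν.1.HasArchParameter χν →
        ∀ (ι : K →+* ℂ) (x y q : ℂ), χσ ι = {x, y} → χν ι = {q} →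
          χπ ι = {x - y + q, q, y - x + q} := by
  sorry

/-- **stub_dihedralVacuity** (= `DihedralVacuity`) — INPUT [L: Gelbart–Jacquet 1978 (3.7)/Remark (9.9) (the lift of
an a.e. self-twist `σ₀` is automorphic non-cuspidal) + Jacquet–Shalika 1981 II Thm 4.4 (isobaric rigidity: no
cuspidal `π` on `GL₃` is nearly equivalent to it, nor to its twists by `ν`)]. -/
theorem stub_dihedralVacuity :
    ∀ (K : Type) [Field K] [NumberField K]
      (h1 : isCompact_glFiniteIntegralLevel 1 K) (hcpt₂ : isCompact_glFiniteIntegralLevel 2 K)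
      (hcpt : isCompact_glFiniteIntegralLevel 3 K)
      (π : CuspidalAutomorphicRepData 3 K hcpt) (σ₀ : CuspidalAutomorphicRepData 2 K hcpt₂)
      (ν : CuspidalAutomorphicRepData 1 K h1)
      (L : Type) [Field L] [NumberField L] [Algebra K L], Module.finrank K L = 2 →
      IsQuadraticSelfTwistAE L σ₀.1 →
      ¬ (∀ᶠ v in cofinite, ∀ α β : Multiset ℂ, π.1.HasSatakeParamAt v α →
        σ₀.1.HasSatakeParamAt v β → ∃ d : ℂ, ν.1.HasSatakeParamAt v {d} ∧
          α = (((β ×ˢ β).map (fun r : ℂ × ℂ => r.1 * r.2⁻¹)).erase 1).map (fun e => d * e)) := by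
  sorry

/-- **stub_descentInfinityType** (= `DescentInfinityType`) — INPUT [L/XL: the tree's named fact
`AutomorphicRepData.exists_hasInfinityType` for cuspidal `GL₂` data = existence of the infinitesimal character
(Dixmier–Schur, proved) + the INTEGRAL PAIRING from the archimedean classification (`K_w`-types integrate)]. -/
theorem stub_descentInfinityType :
    ∀ (K : Type) [Field K] [NumberField K] (hcpt₂ : isCompact_glFiniteIntegralLevel 2 K)
      (σ₀ : CuspidalAutomorphicRepData 2 K hcpt₂), σ₀.1.exists_hasInfinityType := by
  sorry

/-- **stub_centralCharacterDatum** (= `CentralCharacterDatum`) [M/L: `AutomorphicRepData.exists_centralCharacter` +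
`HasArchParameter.apply_one` per place factor + the `GL(1)` datum of a Hecke character
(`GLOneOfHeckeCharacterBJ`) with `hasArchParameter_glOne_of_eq_smul_one`]. -/
theorem stub_centralCharacterDatum :
    ∀ (n : ℕ) [NeZero n] (K : Type) [Field K] [NumberField K]
      (h1 : isCompact_glFiniteIntegralLevel 1 K) (hcpt : isCompact_glFiniteIntegralLevel n K)
      (π : CuspidalAutomorphicRepData n K hcpt) (P : (K →+* ℂ) → Multiset ℂ), π.1.HasArchParameter P →
      ∃ ω : CuspidalAutomorphicRepData 1 K h1, ω.1.HasArchParameter (fun ι => {(P ι).sum}) := by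
  sorry

/-- **stub_halfIntegralTwist** — the route item `HalfIntegralTwistCM` (stmt-Langlands-14036, crux r4) BY NAME:
closes when that item closes (do not re-prove inside this line) [L: Weil's unit criterion on `U²`, Chevalley
1951 Thm 1 (m = 2), Weil/Neukirch extension; `IsCMField` and clause (ii) load-bearing]. -/
theorem stub_halfIntegralTwist :
    Summit.Langlands.Langlands.Theses.IrreducibilityBySelfDuality.HalfIntegralTwistCM := by
  sorry

/-- **stub_twistRealisation** (= `TwistRealisation`) [L: `exists_cuspidalAutomorphicRepData_twist_hecke` + Satake
`eventually_hasSatakeParamAt_of_map_mulChar_detTwist` + GL(1)-datum ↔ Hecke character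
(`exists_heckeCharacter_glOne`, `exists_eq_singleton_of_hasSatakeParamAt_glOne`) + the archimedean shift of a
general Hecke twist (generalising `lieRep_mulChar_twist` / `HasHCParameter.of_twist_norm` from `‖·‖^s` to an
arbitrary archimedean differential)]. -/
theorem stub_twistRealisation :
    ∀ (n : ℕ) [NeZero n] (K : Type) [Field K] [NumberField K]
      (h1 : isCompact_glFiniteIntegralLevel 1 K) (hcpt : isCompact_glFiniteIntegralLevel n K)
      (π : CuspidalAutomorphicRepData n K hcpt) (χ : CuspidalAutomorphicRepData 1 K h1)
      (P : (K →+* ℂ) → Multiset ℂ) (p : (K →+* ℂ) → ℂ),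
      π.1.HasArchParameter P → χ.1.HasArchParameter (fun ι => {p ι}) →
      ∃ π' : CuspidalAutomorphicRepData n K hcpt,
        π'.1.HasArchParameter (fun ι => (P ι).map (· + p ι)) ∧
        ∀ᶠ v in cofinite, ∀ β : Multiset ℂ, π.1.HasSatakeParamAt v β →
          ∃ c : ℂ, χ.1.HasSatakeParamAt v {c} ∧ π'.1.HasSatakeParamAt v (β.map (fun b => c * b)) := by
  sorry

/-! ## The lever: the Petersson–Hermitian mirror (everything in this section is PROVED) -/

/-- **Lever statement, clean invariant form — the mirror for a CLEAN, `A_G`-INVARIANT cuspidal datum (no shift).**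
For a cuspidal Borel–Jacquet datum `π = W / ⊥` on `GL_n(𝔸_K)` (`n ≥ 1`, ANY number field) all of whose forms are
`A_G`-invariant and any archimedean parameter `P` of `π`: `P(ῑ) = {-z̄ : z ∈ P(ι)}` at every complex embedding `ι`
(at a real place `ῑ = ι` and this reads `P = -P̄`). Knapp–Vogan 1995 Ch. IX §1 (0.5); Clozel 1990 Lemme 4.9 (w = 0).
Theorem `cleanInvariantMirror` below. -/
def CleanInvariantMirror : Prop :=
  ∀ (n : ℕ) [NeZero n] (K : Type) [Field K] [NumberField K] (hcpt : isCompact_glFiniteIntegralLevel n K)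
    (π : CuspidalAutomorphicRepData n K hcpt), π.1.W' = ⊥ →
    (∀ φ ∈ π.1.W, ∀ z ∈ (AdelicGroupData.gl n K).center', ∀ g, φ (z * g) = φ g) →
    ∀ (P : (K →+* ℂ) → Multiset ℂ), π.1.HasArchParameter P →
      ∀ ι : K →+* ℂ, P (ComplexEmbedding.conjugate ι) = (P ι).map (fun z => -conj z)

/-- **Lever statement, real-exponent form — the unitary mirror of a cuspidal datum with REAL total exponent.**
For every cuspidal Borel–Jacquet datum `π` on `GL_n(𝔸_K)` (`n ≥ 1`, any number field) with archimedean parameter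
`P` such that `∑_σ ∑ P(σ)` is real (the exponent through which `A_G` acts on a clean model; real for every
C- or L-algebraic `π`, in particular for the crux's regular algebraic `π`), there is ONE real `c` with
`P(ῑ) = {-z̄ + c : z ∈ P(ι)}` at every complex embedding (`c = 2 Re μ/(n[K:ℚ])`). Theorem `unitaryMirrorReal`. -/
def UnitaryMirrorReal : Prop :=
  ∀ (n : ℕ) [NeZero n] (K : Type) [Field K] [NumberField K] (hcpt : isCompact_glFiniteIntegralLevel n K)
    (π : CuspidalAutomorphicRepData n K hcpt) (P : (K →+* ℂ) → Multiset ℂ), π.1.HasArchParameter P →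
      (∑ σ : K →+* ℂ, (P σ).sum).im = 0 →
      ∃ c : ℝ, ∀ ι : K →+* ℂ,
        P (ComplexEmbedding.conjugate ι) = (P ι).map (fun z => -conj z + (c : ℂ))

set_option maxHeartbeats 400000 in
-- (the adelic function spaces make `whnf`/`isDefEq` on the transported Petersson form expensive)
/-- **The mirror for a clean `A_G`-invariant cuspidal datum — PROVED** (the card's K2 "assembly risk",
discharged). The Petersson pairing `⟪φ, ψ⟫_μ = ∫ φ̃ conj ψ̃ dμ` (`AdelicGroupData.l2Pairing`) for an
automorphic measure `μ` (`exists_isAutomorphicMeasure_gl_holds`, Borel–Harish-Chandra) is defined on the forms of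
`π` because `A_G`-invariant cusp forms are bounded (`AutomorphicRepsGL.cuspidal_bounded_holds`,
`le_bddInvariant_of_cuspidal_bounded`); transported to `W / W' = W / ⊥ ≅ W` (`Submodule.quotEquivOfEqBot`) it is
sesquilinear (`l2Pairing_add_left/right`, `l2Pairing_smul_left/right`), the Lie action of `HasArchParameter` is
differentiation of forms (`HasLieAction`) and 𝔤 acts skew-symmetrically (`AutomorphyDatum.l2Pairing_lieDeriv_add_eq_zero`,
Knapp–Vogan (0.5)), and `⟪φ, φ⟫ ≠ 0` for `φ ≠ 0` (`eq_zero_of_l2Pairing_self_eq_zero`; `W ≠ W' = ⊥`); so the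
Lie-level theorem `HasArchParameter.map_neg_conj_of_skewHermitian` (HermitianArchParameter) applies.
Knapp–Vogan 1995 Ch. IX §1; Clozel 1990 Lemme 4.9 (weight `0`). -/
theorem cleanInvariantMirror : CleanInvariantMirror := by
  intro n _ K _ _ hcpt π h0 hAG P hP ι
  classical
  -- an automorphic measure on `GL_n(𝔸_K) ⧸ A_G GL_n(K)` (Borel–Harish-Chandra, proved)
  obtain ⟨μ, hμ⟩ := AdelicGroupData.exists_isAutomorphicMeasure_gl_holds n K
  haveI := hμ
  -- the forms of `π` are bounded continuous left-`A_G GL_n(K)`-invariant functions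
  have hWb : π.1.W ≤ (AdelicGroupData.gl n K).bddInvariant :=
    AutomorphicRepsGL.le_bddInvariant_of_cuspidal_bounded AutomorphicRepsGL.cuspidal_bounded_holds π.2 hAG
  -- the Lie algebra action carrying the archimedean parameter
  obtain ⟨ρ𝔤, hρ, hχ⟩ := hP
  -- `W' = ⊥`: the representation space `W / W'` is `W`
  have hker : π.1.kerQuot = ⊥ := by
    show π.1.W'.comap π.1.W.subtype = ⊥
    rw [h0, Submodule.comap_bot, Submodule.ker_subtype]
  obtain ⟨e, he, he'⟩ : ∃ e : π.1.Quot ≃ₗ[ℂ] π.1.W,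
      (∀ φ : π.1.W, e (π.1.mkQ φ) = φ) ∧ (∀ v : π.1.Quot, π.1.mkQ (e v) = v) := by
    refine ⟨Submodule.quotEquivOfEqBot _ hker, fun φ => Submodule.quotEquivOfEqBot_apply_mk _ hker φ,
      fun v => ?_⟩
    have h := (Submodule.quotEquivOfEqBot _ hker).symm_apply_apply v
    rw [Submodule.quotEquivOfEqBot_symm_apply] at h
    exact h
  have hmem : ∀ v : π.1.Quot,
      ((e v : π.1.W) : (AdelicGroupData.gl n K).Adelic → ℂ) ∈ (AdelicGroupData.gl n K).bddInvariant :=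
    fun v => hWb (e v).2
  -- the Petersson form, transported to `W / W'`: `B v w = ⟪e v, e w⟫_μ`
  have hadd₁ : ∀ u v w : π.1.Quot,
      (AdelicGroupData.gl n K).l2Pairing μ ((e (u + v) : π.1.W) : (AdelicGroupData.gl n K).Adelic → ℂ)
          ((e w : π.1.W) : (AdelicGroupData.gl n K).Adelic → ℂ) =
        (AdelicGroupData.gl n K).l2Pairing μ ((e u : π.1.W) : (AdelicGroupData.gl n K).Adelic → ℂ)
            ((e w : π.1.W) : (AdelicGroupData.gl n K).Adelic → ℂ) +
          (AdelicGroupData.gl n K).l2Pairing μ ((e v : π.1.W) : (AdelicGroupData.gl n K).Adelic → ℂ)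
            ((e w : π.1.W) : (AdelicGroupData.gl n K).Adelic → ℂ) := by
    intro u v w
    simp only [map_add, Submodule.coe_add]
    exact AdelicGroupData.l2Pairing_add_left (hmem u) (hmem v) (hmem w)
  have hadd₂ : ∀ u v w : π.1.Quot,
      (AdelicGroupData.gl n K).l2Pairing μ ((e u : π.1.W) : (AdelicGroupData.gl n K).Adelic → ℂ)
          ((e (v + w) : π.1.W) : (AdelicGroupData.gl n K).Adelic → ℂ) =
        (AdelicGroupData.gl n K).l2Pairing μ ((e u : π.1.W) : (AdelicGroupData.gl n K).Adelic → ℂ)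
            ((e v : π.1.W) : (AdelicGroupData.gl n K).Adelic → ℂ) +
          (AdelicGroupData.gl n K).l2Pairing μ ((e u : π.1.W) : (AdelicGroupData.gl n K).Adelic → ℂ)
            ((e w : π.1.W) : (AdelicGroupData.gl n K).Adelic → ℂ) := by
    intro u v w
    simp only [map_add, Submodule.coe_add]
    exact AdelicGroupData.l2Pairing_add_right (hmem u) (hmem v) (hmem w)
  have hsmul₁ : ∀ (c : ℂ) (v w : π.1.Quot),
      (AdelicGroupData.gl n K).l2Pairing μ ((e (c • v) : π.1.W) : (AdelicGroupData.gl n K).Adelic → ℂ)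
          ((e w : π.1.W) : (AdelicGroupData.gl n K).Adelic → ℂ) =
        c * (AdelicGroupData.gl n K).l2Pairing μ ((e v : π.1.W) : (AdelicGroupData.gl n K).Adelic → ℂ)
          ((e w : π.1.W) : (AdelicGroupData.gl n K).Adelic → ℂ) := by
    intro c v w
    simp only [map_smul, Submodule.coe_smul]
    exact AdelicGroupData.l2Pairing_smul_left c _ _
  have hsmul₂ : ∀ (c : ℂ) (v w : π.1.Quot),
      (AdelicGroupData.gl n K).l2Pairing μ ((e v : π.1.W) : (AdelicGroupData.gl n K).Adelic → ℂ)
          ((e (c • w) : π.1.W) : (AdelicGroupData.gl n K).Adelic → ℂ) =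
        conj c * (AdelicGroupData.gl n K).l2Pairing μ ((e v : π.1.W) : (AdelicGroupData.gl n K).Adelic → ℂ)
          ((e w : π.1.W) : (AdelicGroupData.gl n K).Adelic → ℂ) := by
    intro c v w
    simp only [map_smul, Submodule.coe_smul]
    exact AdelicGroupData.l2Pairing_smul_right c _ _
  -- the Lie action is differentiation of forms: `e (X v) = X (e v)`
  have heρ : ∀ (X : (AutomorphyDatum.gl n K hcpt).arch.lie) (v : π.1.Quot),
      e (ρ𝔤 X v) = π.1.lieDerivW X (e v) := by
    intro X v
    have h1 : ρ𝔤 X v = π.1.mkQ (π.1.lieDerivW X (e v)) :=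
      (congrArg (ρ𝔤 X) (he' v).symm).trans (hρ X (e v))
    exact (congrArg e h1).trans (he _)
  -- `𝔤` acts by skew-symmetric operators (Knapp–Vogan (0.5), proved in tree for the `L²` pairing)
  have hskew' : ∀ (X : (AutomorphyDatum.gl n K hcpt).arch.lie) (v w : π.1.Quot),
      (AdelicGroupData.gl n K).l2Pairing μ ((e (ρ𝔤 X v) : π.1.W) : (AdelicGroupData.gl n K).Adelic → ℂ)
          ((e w : π.1.W) : (AdelicGroupData.gl n K).Adelic → ℂ) =
        -(AdelicGroupData.gl n K).l2Pairing μ ((e v : π.1.W) : (AdelicGroupData.gl n K).Adelic → ℂ)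
          ((e (ρ𝔤 X w) : π.1.W) : (AdelicGroupData.gl n K).Adelic → ℂ) := by
    intro X v w
    have h := (AutomorphyDatum.gl n K hcpt).l2Pairing_lieDeriv_add_eq_zero (μ := μ) X (hmem v) (hmem w)
      (π.1.stable.isArchSmooth (e v).2) (π.1.stable.isArchSmooth (e w).2)
      (hWb (π.1.stable.lie_stable X _ (e v).2)) (hWb (π.1.stable.lie_stable X _ (e w).2))
    have h' := eq_neg_of_add_eq_zero_left h
    have h1 := congrArg (fun φ : π.1.W => (AdelicGroupData.gl n K).l2Pairing μ
      (φ : (AdelicGroupData.gl n K).Adelic → ℂ) ((e w : π.1.W) : (AdelicGroupData.gl n K).Adelic → ℂ))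
      (heρ X v)
    have h2 := congrArg (fun φ : π.1.W => (AdelicGroupData.gl n K).l2Pairing μ
      ((e v : π.1.W) : (AdelicGroupData.gl n K).Adelic → ℂ) (φ : (AdelicGroupData.gl n K).Adelic → ℂ))
      (heρ X w)
    exact h1.trans (h'.trans (congrArg (fun z : ℂ => -z) h2).symm)
  have hskew : ∀ (Y : Matrix (Fin n) (Fin n) (mixedSpace K)) (v w : π.1.Quot),
      (AdelicGroupData.gl n K).l2Pairing μ
          ((e ((ρ𝔤.comp (LieSubalgebra.topEquiv :
            (⊤ : LieSubalgebra ℝ (Matrix (Fin n) (Fin n) (mixedSpace K))) ≃ₗ⁅ℝ⁆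
              Matrix (Fin n) (Fin n) (mixedSpace K)).symm.toLieHom) Y v) : π.1.W) :
            (AdelicGroupData.gl n K).Adelic → ℂ)
          ((e w : π.1.W) : (AdelicGroupData.gl n K).Adelic → ℂ) =
        -(AdelicGroupData.gl n K).l2Pairing μ ((e v : π.1.W) : (AdelicGroupData.gl n K).Adelic → ℂ)
          ((e ((ρ𝔤.comp (LieSubalgebra.topEquiv :
            (⊤ : LieSubalgebra ℝ (Matrix (Fin n) (Fin n) (mixedSpace K))) ≃ₗ⁅ℝ⁆
              Matrix (Fin n) (Fin n) (mixedSpace K)).symm.toLieHom) Y w) : π.1.W) :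
            (AdelicGroupData.gl n K).Adelic → ℂ) :=
    fun Y v w => hskew' _ v w
  -- a vector of non-zero length: `W ≠ W' = ⊥` and the pairing is positive definite
  obtain ⟨φ, hφW, hφ0⟩ : ∃ φ ∈ π.1.W, φ ≠ 0 := by
    have hlt := π.1.lt
    rw [h0, bot_lt_iff_ne_bot] at hlt
    exact (Submodule.ne_bot_iff _).mp hlt
  have hv : (AdelicGroupData.gl n K).l2Pairing μ
      ((e (π.1.mkQ ⟨φ, hφW⟩) : π.1.W) : (AdelicGroupData.gl n K).Adelic → ℂ)
      ((e (π.1.mkQ ⟨φ, hφW⟩) : π.1.W) : (AdelicGroupData.gl n K).Adelic → ℂ) ≠ 0 := by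
    rw [he]
    intro h
    exact hφ0 (AdelicGroupData.eq_zero_of_l2Pairing_self_eq_zero (hWb hφW) h)
  exact hχ.map_neg_conj_of_skewHermitian
    (fun v w => (AdelicGroupData.gl n K).l2Pairing μ ((e v : π.1.W) : (AdelicGroupData.gl n K).Adelic → ℂ)
      ((e w : π.1.W) : (AdelicGroupData.gl n K).Adelic → ℂ))
    hadd₁ hadd₂ hsmul₁ hsmul₂ hskew hv ι



/-- **The unitary mirror for real total exponent, from the clean invariant mirror (no sorry).** Pass to a clean
model `π₀ = W₀/⊥` with the same parameter (semisimplicity of `A_G`-isotypic cusp forms, proved); `A_G` acts on it by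
`a ↦ a^μ` with `μ = ∑_σ ∑ P(σ)` REAL; twist by the real power `|det|^{r}`, `r = -μ/(n[K:ℚ])`, to an
`A_G`-INVARIANT clean cuspidal datum `π₁` with parameter `P + r` (tree, real exponents); apply the invariant mirror
and untwist: `P(ῑ) + r = -conj(P(ι) + r)`, i.e. `c = -2r`. -/
theorem unitaryMirrorReal_of (hS2 : CleanInvariantMirror) : UnitaryMirrorReal := by
  intro n _ K _ _ hcpt π P hP hreal
  classical
  -- clean model with the same archimedean parameter
  obtain ⟨π₀, h0, -, h0arch⟩ :=
    π.exists_clean_hasSatakeParamAt_hasArchParameter_of_sSup_irreducible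
      AutomorphicRepsGL.stable_cuspidal_eq_sSup_irreducible_holds
  have hP₀ : π₀.1.HasArchParameter P := h0arch P hP
  -- `A_G` acts on the clean model by `a ↦ a^μ`, `μ = ∑_σ ∑ P(σ)` (real by hypothesis)
  set μ : ℂ := ∑ σ : K →+* ℂ, (P σ).sum with hμdef
  have hμ : ∀ φ ∈ π₀.1.W, ∀ (t : ℝ≥0ˣ) (g : (AdelicGroupData.gl n K).Adelic),
      φ ((show (AdelicGroupData.gl n K).Adelic from posRealScalar n K t) * g) =
        (((t : ℝ≥0) : ℝ) : ℂ) ^ μ * φ g :=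
    fun φ hφ t g => hP₀.apply_posRealScalar_mul_of_W'_eq_bot h0 hφ t g
  have hμre : ((μ.re : ℝ) : ℂ) = μ := by
    apply Complex.ext
    · simp
    · simp [hreal]
  -- the REAL normalising exponent `r = -μ/(n[K:ℚ])`
  have hnd : ((n * Module.finrank ℚ K : ℕ) : ℂ) ≠ 0 := by
    exact_mod_cast (Nat.mul_ne_zero (NeZero.ne n) Module.finrank_pos.ne')
  set r : ℝ := -μ.re / ((n * Module.finrank ℚ K : ℕ) : ℝ) with hr
  have hrc : ((r : ℝ) : ℂ) = -μ / ((n * Module.finrank ℚ K : ℕ) : ℂ) := by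
    rw [hr, Complex.ofReal_div, Complex.ofReal_neg, Complex.ofReal_natCast, hμre]
  have hs : ((r : ℝ) : ℂ) * (n * Module.finrank ℚ K : ℕ) = -μ := by
    rw [hrc, div_mul_cancel₀ _ hnd]
  obtain ⟨χ, hχ⟩ := exists_heckeCharacter_ideleNorm_cpow K ((r : ℝ) : ℂ)
  -- the twisted datum `π₁ = π₀ ⊗ |det|^{r}`: clean, `A_G`-invariant, parameter `P + r`
  obtain ⟨π₁, h1W, h1W'⟩ := exists_cuspidalAutomorphicRepData_map_mulChar_detTwist hχ π₀
  have hAG : ∀ φ ∈ π₁.1.W, ∀ z ∈ (AdelicGroupData.gl n K).center', ∀ g, φ (z * g) = φ g := by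
    intro φ hφ z hz g
    rw [h1W] at hφ
    obtain ⟨φ₀, hφ₀, rfl⟩ := hφ
    obtain ⟨t, rfl⟩ := hz
    exact mulChar_detTwist_apply_posRealScalar_mul_of_cpow hχ hs (hμ φ₀ hφ₀) t g
  have h1W'bot : π₁.1.W' = ⊥ := by rw [h1W', h0, Submodule.map_bot]
  have hP₁ : π₁.1.HasArchParameter (fun σ => (P σ).map (· + ((r : ℝ) : ℂ))) :=
    AutomorphicRepData.HasArchParameter.of_map_mulChar_detTwist hχ h1W h1W' hP₀
  -- the invariant mirror for `π₁`, untwisted: `c = -2r`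
  have hmir := hS2 n K hcpt π₁ h1W'bot hAG _ hP₁
  refine ⟨-(2 * r), fun ι => ?_⟩
  have h := congrArg (Multiset.map (fun z : ℂ => z - ((r : ℝ) : ℂ))) (hmir ι)
  simp only [Multiset.map_map, Function.comp_def, add_sub_cancel_right, Multiset.map_id'] at h
  rw [h]
  refine Multiset.map_congr rfl (fun z _ => ?_)
  rw [map_add, Complex.conj_ofReal]
  push_cast
  ring

/-- **The unitary mirror of every cuspidal Borel–Jacquet datum with real total exponent — PROVED.** -/
theorem unitaryMirrorReal : UnitaryMirrorReal :=
  unitaryMirrorReal_of cleanInvariantMirror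

/-! ## Bookkeeping lemmas (proved) -/

/-- **Parity from the mirror of an adjoint parameter** (three-term arithmetic progressions; Disproof F6: `b = ∓a`,
the sign is irrelevant). If `{s₁' - s₂' + q', q', s₂' - s₁' + q'}` is the mirror `z ↦ -z̄ + c` of
`{s₁ - s₂ + q, q, s₂ - s₁ + q}` with `s₁ - s₂, q ∈ ℤ` and `s₁' - s₂' ≠ 0`, then comparing means gives `q' = c - q`,
and `s₁' - s₂' ∈ {-(s₁ - s₂), 0, s₁ - s₂}` with `0` excluded, so `(s₁ - s₂) + (s₁' - s₂') ∈ {0, 2(s₁ - s₂)} ⊂ 2ℤ`. -/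
theorem parity_of_mirror3 {s₁ s₂ q s₁' s₂' q' : ℂ} {c : ℝ} (hZa : ∃ k : ℤ, s₁ - s₂ = k)
    (hZq : ∃ k : ℤ, q = k) (ha' : s₁' - s₂' ≠ 0)
    (h : ({s₁' - s₂' + q', q', s₂' - s₁' + q'} : Multiset ℂ) =
      (({s₁ - s₂ + q, q, s₂ - s₁ + q} : Multiset ℂ)).map (fun z => -conj z + (c : ℂ))) :
    ∃ m : ℤ, (s₁ - s₂) + (s₁' - s₂') = 2 * m := by
  obtain ⟨k, hk⟩ := hZa
  obtain ⟨l, hl⟩ := hZq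
  have hk' : s₂ - s₁ = -(k : ℂ) := by linear_combination -hk
  rw [hk, hk', hl] at h
  simp only [Multiset.insert_eq_cons, Multiset.map_cons, Multiset.map_singleton, map_add, map_neg,
    map_intCast] at h
  -- the means agree: `3 q' = 3 (c - l)`
  have hsum := congrArg Multiset.sum h
  simp only [Multiset.sum_cons, Multiset.sum_singleton] at hsum
  have hq' : q' = -(l : ℂ) + c := by linear_combination hsum / 3
  -- `s₁' - s₂' + q'` is one of the three mirrored entries
  have hmem : s₁' - s₂' + q' ∈ ((-((k : ℂ) + l) + (c : ℂ)) ::ₘ (-(l : ℂ) + (c : ℂ)) ::ₘ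
      ({-(-(k : ℂ) + l) + (c : ℂ)} : Multiset ℂ)) := by
    rw [← h]
    exact Multiset.mem_cons_self _ _
  simp only [Multiset.mem_cons, Multiset.mem_singleton] at hmem
  rcases hmem with h1 | h1 | h1
  · exact ⟨0, by push_cast; linear_combination hk + h1 - hq'⟩
  · exact absurd (by linear_combination h1 - hq') ha'
  · exact ⟨k, by linear_combination hk + h1 - hq'⟩

/-- **An integral archimedean parameter has real total exponent** (so `unitaryMirrorReal` applies to every
C- or L-algebraic datum, in particular to the crux's regular algebraic `π`). -/
theorem im_totalExponent_eq_zero_of_integral {K : Type} [Field K] [NumberField K] {P : (K →+* ℂ) → Multiset ℂ}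
    (hint : ∀ ι, ∀ z ∈ P ι, ∃ k : ℤ, z = k) : (∑ σ : K →+* ℂ, (P σ).sum).im = 0 := by
  have key : ∀ m : Multiset ℂ, (∀ z ∈ m, ∃ k : ℤ, z = k) → m.sum.im = 0 := by
    intro m hm
    induction m using Multiset.induction_on with
    | empty => simp
    | cons a m ih =>
      rw [Multiset.sum_cons, Complex.add_im, ih (fun z hz => hm z (Multiset.mem_cons_of_mem hz))]
      obtain ⟨k, hk⟩ := hm a (Multiset.mem_cons_self a m)
      rw [hk]
      simp
  rw [Complex.im_sum]
  exact Finset.sum_eq_zero (fun σ _ => key (P σ) (hint σ))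

/-- **Paired exponent functions from a well-formed rank-2 infinity type.** If `σ₀` (any datum on `GL₂`) has
infinity type `T`, there are functions `s₁ s₂` on the complex embeddings with `{s₁ ι, s₂ ι}` the archimedean
parameter at `ι` and `s_i ι - s_i ῑ ∈ ℤ` (choose, above each place `w`, an enumeration `{ω₁, ω₂}` of
`T σ_w` and put `s_i σ_w = a(ω_i)`, `s_i σ̄_w = b(ω_i)`; at a real place `σ̄_w = σ_w`). -/
theorem exists_paired_exponents_of_hasInfinityType {K : Type} [Field K] [NumberField K]
    {hcpt₂ : isCompact_glFiniteIntegralLevel 2 K} {σ₀ : AutomorphicRepData (AutomorphyDatum.gl 2 K hcpt₂)}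
    {T : InfinityType K 2} (hT : σ₀.HasInfinityType T) :
    ∃ s₁ s₂ : (K →+* ℂ) → ℂ, σ₀.HasArchParameter (fun ι => {s₁ ι, s₂ ι}) ∧
      ∀ ι : K →+* ℂ, (∃ m : ℤ, s₁ ι - s₁ (ComplexEmbedding.conjugate ι) = m) ∧
        (∃ m : ℤ, s₂ ι - s₂ (ComplexEmbedding.conjugate ι) = m) := by
  classical
  obtain ⟨⟨hcard, hswap⟩, harch⟩ := hT
  -- an enumeration of `T` above each place, read at the distinguished embedding `σ_w`
  have hex : ∀ w : InfinitePlace K, ∃ xy : ArchWeight × ArchWeight, T w.embedding = {xy.1, xy.2} := by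
    intro w
    obtain ⟨x, y, hxy⟩ := Multiset.card_eq_two.mp (hcard w.embedding)
    exact ⟨(x, y), hxy⟩
  choose e he using hex
  -- the exponent functions
  let s₁ : (K →+* ℂ) → ℂ := fun ι =>
    if ι = (InfinitePlace.mk ι).embedding then (e (InfinitePlace.mk ι)).1.a else (e (InfinitePlace.mk ι)).1.b
  let s₂ : (K →+* ℂ) → ℂ := fun ι =>
    if ι = (InfinitePlace.mk ι).embedding then (e (InfinitePlace.mk ι)).2.a else (e (InfinitePlace.mk ι)).2.b
  -- every embedding is `σ_w` or `σ̄_w`, `w = mk ι`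
  have hdich : ∀ ι : K →+* ℂ, ι = (InfinitePlace.mk ι).embedding ∨
      (ι ≠ (InfinitePlace.mk ι).embedding ∧ ι = ComplexEmbedding.conjugate (InfinitePlace.mk ι).embedding) := by
    intro ι
    by_cases h : ι = (InfinitePlace.mk ι).embedding
    · exact Or.inl h
    · right
      refine ⟨h, ?_⟩
      rcases InfinitePlace.mk_eq_iff.mp (InfinitePlace.mk_embedding (InfinitePlace.mk ι)) with h1 | h1
      · exact absurd h1.symm h
      · exact h1.symm
  -- the parameter multisets agree
  have hmul : ∀ ι : K →+* ℂ, ({s₁ ι, s₂ ι} : Multiset ℂ) = (T ι).map ArchWeight.a := by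
    intro ι
    rcases hdich ι with h | ⟨hne, h⟩
    · have e1 : s₁ ι = (e (InfinitePlace.mk ι)).1.a := if_pos h
      have e2 : s₂ ι = (e (InfinitePlace.mk ι)).2.a := if_pos h
      rw [e1, e2]
      conv_rhs => rw [h, he (InfinitePlace.mk ι)]
      simp
    · have e1 : s₁ ι = (e (InfinitePlace.mk ι)).1.b := if_neg hne
      have e2 : s₂ ι = (e (InfinitePlace.mk ι)).2.b := if_neg hne
      rw [e1, e2]
      conv_rhs => rw [h, hswap, he (InfinitePlace.mk ι)]
      simp
  refine ⟨s₁, s₂, ?_, fun ι => ?_⟩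
  · have hfun : (fun ι : K →+* ℂ => ({s₁ ι, s₂ ι} : Multiset ℂ)) = fun ι => (T ι).map ArchWeight.a :=
      funext hmul
    rw [hfun]
    exact harch
  · -- the pairing
    have hmk : InfinitePlace.mk (ComplexEmbedding.conjugate ι) = InfinitePlace.mk ι :=
      InfinitePlace.mk_conjugate_eq ι
    rcases hdich ι with h | ⟨hne, h⟩
    · by_cases hr : ComplexEmbedding.conjugate ι = ι
      · -- real place
        refine ⟨⟨0, ?_⟩, ⟨0, ?_⟩⟩ <;> simp [hr]
      · -- complex place, `ι = σ_w`: `ῑ` takes the `b`-branch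
        have hne' : ComplexEmbedding.conjugate ι ≠ (InfinitePlace.mk (ComplexEmbedding.conjugate ι)).embedding := by
          rw [hmk, ← h]
          exact hr
        have e1 : s₁ ι = (e (InfinitePlace.mk ι)).1.a := if_pos h
        have e2 : s₂ ι = (e (InfinitePlace.mk ι)).2.a := if_pos h
        have f1 : s₁ (ComplexEmbedding.conjugate ι) = (e (InfinitePlace.mk ι)).1.b := by
          show (if _ then _ else _) = _
          rw [if_neg hne', hmk]
        have f2 : s₂ (ComplexEmbedding.conjugate ι) = (e (InfinitePlace.mk ι)).2.b := by
          show (if _ then _ else _) = _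
          rw [if_neg hne', hmk]
        rw [e1, e2, f1, f2]
        exact ⟨(e (InfinitePlace.mk ι)).1.exists_int_sub, (e (InfinitePlace.mk ι)).2.exists_int_sub⟩
    · -- complex place, `ι = σ̄_w`: `ῑ = σ_w` takes the `a`-branch
      have hci : ComplexEmbedding.conjugate ι = (InfinitePlace.mk ι).embedding :=
        (congrArg ComplexEmbedding.conjugate h).trans (star_star _)
      have hpos : ComplexEmbedding.conjugate ι = (InfinitePlace.mk (ComplexEmbedding.conjugate ι)).embedding := by
        rw [hmk]
        exact hci
      have e1 : s₁ ι = (e (InfinitePlace.mk ι)).1.b := if_neg hne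
      have e2 : s₂ ι = (e (InfinitePlace.mk ι)).2.b := if_neg hne
      have f1 : s₁ (ComplexEmbedding.conjugate ι) = (e (InfinitePlace.mk ι)).1.a := by
        show (if _ then _ else _) = _
        rw [if_pos hpos, hmk]
      have f2 : s₂ (ComplexEmbedding.conjugate ι) = (e (InfinitePlace.mk ι)).2.a := by
        show (if _ then _ else _) = _
        rw [if_pos hpos, hmk]
      rw [e1, e2, f1, f2]
      obtain ⟨m₁, hm₁⟩ := (e (InfinitePlace.mk ι)).1.exists_int_sub
      obtain ⟨m₂, hm₂⟩ := (e (InfinitePlace.mk ι)).2.exists_int_sub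
      exact ⟨⟨-m₁, by push_cast; linear_combination -hm₁⟩, ⟨-m₂, by push_cast; linear_combination -hm₂⟩⟩

/-! ## The composition: the six stubs imply the crux, by name (kernel-checked, no sorry of its own) -/

/-- **The line concludes the crux — binder form** over the six stub statements (conclusion `Crux`, the route
decl by `abbrev`): `AdjointArchShadowNonDihedral → DihedralVacuity → DescentInfinityType → CentralCharacterDatum →
HalfIntegralTwistCM →
TwistRealisation → RegularTwistCM`. Uses of the crux's hypotheses: `IsCMField` only through `HalfIntegralTwistCM`;
`π.1.IsRegularAlgebraic` for integrality (`s₁ ι - s₂ ι ∈ ℤ`, `q ι ∈ ℤ`), regularity (`s₁ ι ≠ s₂ ι`) AND the reality of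
the total exponent of `π` (which licenses the proved mirror `unitaryMirrorReal`); the adjoint identity only through
the adjoint shadow; the PARITY (iii) of `HalfIntegralTwistCM` from the mirror of `π` (`parity_of_mirror3`). The
twisting datum `χ` is whatever `HalfIntegralTwistCM` returns (never asked to be algebraic: Disproof F4/F8 avoided). -/
theorem RegularTwistCM_of_stubs
    (hA : AdjointArchShadowNonDihedral) (hV : DihedralVacuity) (hD : DescentInfinityType)
    (hC : CentralCharacterDatum)
    (hH : Summit.Langlands.Langlands.Theses.IrreducibilityBySelfDuality.HalfIntegralTwistCM)
    (hT : TwistRealisation) : Crux := by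
  intro K _ _ hCM h1 hcpt₂ hcpt π σ₀ ν hRA hAd
  classical
  haveI : NeZero (2 : ℕ) := ⟨by norm_num⟩
  -- Step 0 (INPUT stub 1b): `σ₀` is not an a.e. quadratic self-twist (else the a.e. identity is impossible)
  have hnd : ∀ (L : Type) [Field L] [NumberField L] [Algebra K L], Module.finrank K L = 2 →
      ¬ IsQuadraticSelfTwistAE L σ₀.1 :=
    fun L _ _ _ hL hst => hV K h1 hcpt₂ hcpt π σ₀ ν L hL hst hAd
  -- Step 1 (INPUT stub 2): paired exponent functions of `σ₀`
  obtain ⟨T₀, hT₀⟩ := hD K hcpt₂ σ₀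
  obtain ⟨s₁, s₂, hσ, hpair⟩ := exists_paired_exponents_of_hasInfinityType hT₀
  -- Step 2 (tree): the archimedean parameter `{q ι}` of the `GL(1)` datum `ν`
  obtain ⟨χν, hχν⟩ := ν.1.exists_hasArchParameter_glOne
  have hq : ∃ q : (K →+* ℂ) → ℂ, ∀ ι, χν ι = {q ι} := by
    have h1c : ∀ ι, ∃ a, χν ι = {a} := fun ι =>
      Multiset.card_eq_one.mp (AutomorphicRepData.card_eq_of_hasArchParameter hχν ι)
    choose q hq using h1c
    exact ⟨q, hq⟩
  obtain ⟨q, hq⟩ := hq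
  -- Step 3: the regular algebraic infinity type of `π`
  obtain ⟨T, ⟨hTwf, hTarch⟩, hTC, hTreg⟩ := hRA
  -- Step 4 (INPUT stub 1): the adjoint shadow at every embedding
  have hsh : ∀ ι, (T ι).map ArchWeight.a = {s₁ ι - s₂ ι + q ι, q ι, s₂ ι - s₁ ι + q ι} :=
    fun ι => hA K h1 hcpt₂ hcpt π σ₀ ν hnd hAd _ _ _ hTarch hσ hχν ι (s₁ ι) (s₂ ι) (q ι) rfl (hq ι)
  -- Step 5: integrality from C-algebraicity of `π` (`n = 3`: exponents in `1 + ℤ = ℤ`)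
  have hint : ∀ ι, ∀ z ∈ (T ι).map ArchWeight.a, ∃ k : ℤ, z = k := by
    intro ι z hz
    obtain ⟨w, hw, rfl⟩ := Multiset.mem_map.mp hz
    obtain ⟨k, l, hk, -⟩ := hTC ι w hw
    exact ⟨k + 1, by rw [hk]; push_cast; ring⟩
  have hqZ : ∀ ι, ∃ k : ℤ, q ι = k := fun ι => hint ι (q ι) (by rw [hsh ι]; simp)
  have haZ : ∀ ι, ∃ k : ℤ, s₁ ι - s₂ ι = k := by
    intro ι
    obtain ⟨k₁, hk₁⟩ := hint ι (s₁ ι - s₂ ι + q ι) (by rw [hsh ι]; simp)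
    obtain ⟨k₂, hk₂⟩ := hqZ ι
    exact ⟨k₁ - k₂, by push_cast; linear_combination hk₁ - hk₂⟩
  -- Step 6: regularity of `π` forces `s₁ ι ≠ s₂ ι`
  have ha0 : ∀ ι, s₁ ι - s₂ ι ≠ 0 := by
    intro ι h0
    have hnd := hTreg ι
    rw [hsh ι, Multiset.insert_eq_cons, Multiset.nodup_cons] at hnd
    apply hnd.1
    rw [h0, zero_add]
    simp
  -- Step 7 (LEVER, proved): the unitary mirror of `π` itself — its parameter is integral, so its total exponent
  -- is real (`unitaryMirrorReal`) — and the parity of `(s₁-s₂)(ι) + (s₁-s₂)(ῑ)` from the mirrored adjoint shape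
  have him : (∑ σ : K →+* ℂ, ((T σ).map ArchWeight.a).sum).im = 0 :=
    im_totalExponent_eq_zero_of_integral hint
  obtain ⟨c, hc⟩ := unitaryMirrorReal 3 K hcpt π _ hTarch him
  have hpar : ∀ ι, ∃ m : ℤ, (s₁ ι - s₂ ι) +
      (s₁ (ComplexEmbedding.conjugate ι) - s₂ (ComplexEmbedding.conjugate ι)) = 2 * m := by
    intro ι
    have h := hc ι
    rw [hsh ι, hsh (ComplexEmbedding.conjugate ι)] at h
    exact parity_of_mirror3 (haZ ι) (hqZ ι) (ha0 (ComplexEmbedding.conjugate ι)) h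
  -- Step 8 (stub 3): the central character of `σ₀` as a `GL(1)` datum with parameter `{s₁ ι + s₂ ι}`
  obtain ⟨ω, hω⟩ := hC 2 K h1 hcpt₂ σ₀ _ hσ
  have hω' : ω.1.HasArchParameter (fun ι => {s₁ ι + s₂ ι}) := by
    have e : (fun ι : K →+* ℂ => ({(({s₁ ι, s₂ ι} : Multiset ℂ)).sum} : Multiset ℂ)) =
        fun ι => {s₁ ι + s₂ ι} := by
      funext ι
      simp
    rw [← e]
    exact hω
  -- Step 9 (stub 4 = route item HalfIntegralTwistCM): the half-integral twisting `GL(1)` datum `χ`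
  obtain ⟨χ, p, hχ, hp⟩ := hH K hCM h1 s₁ s₂ haZ (fun ι => (hpair ι).1) hpar ⟨ω, hω'⟩
  -- Step 10 (stub 5): realise `σ = σ₀ ⊗ χ`
  obtain ⟨σ, hσarch, hσsat⟩ := hT 2 K h1 hcpt₂ σ₀ χ _ p hσ hχ
  refine ⟨σ, χ, ?_, hσsat⟩
  -- Step 11: the regular algebraic certificate of `σ` (explicit well-formed infinity type)
  choose mp hmp using hp
  choose ma hma using haZ
  have hw₁ : ∀ ι, ∃ m : ℤ, (s₁ ι + p ι) -
      (s₁ (ComplexEmbedding.conjugate ι) + p (ComplexEmbedding.conjugate ι)) = m := fun ι =>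
    ⟨mp ι - mp (ComplexEmbedding.conjugate ι), by
      push_cast; linear_combination hmp ι - hmp (ComplexEmbedding.conjugate ι)⟩
  have hw₂ : ∀ ι, ∃ m : ℤ, (s₂ ι + p ι) -
      (s₂ (ComplexEmbedding.conjugate ι) + p (ComplexEmbedding.conjugate ι)) = m := fun ι =>
    ⟨mp ι - mp (ComplexEmbedding.conjugate ι) - ma ι + ma (ComplexEmbedding.conjugate ι), by
      push_cast
      linear_combination hmp ι - hmp (ComplexEmbedding.conjugate ι) - hma ι +
        hma (ComplexEmbedding.conjugate ι)⟩
  let Tσ : InfinityType K 2 := fun ι =>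
    {⟨s₁ ι + p ι, s₁ (ComplexEmbedding.conjugate ι) + p (ComplexEmbedding.conjugate ι), hw₁ ι⟩,
     ⟨s₂ ι + p ι, s₂ (ComplexEmbedding.conjugate ι) + p (ComplexEmbedding.conjugate ι), hw₂ ι⟩}
  have hTa : ∀ ι, (Tσ ι).map ArchWeight.a = {s₁ ι + p ι, s₂ ι + p ι} := fun ι => by simp [Tσ]
  refine ⟨Tσ, ⟨⟨fun ι => by simp [Tσ], fun ι => ?_⟩, ?_⟩, fun ι w hw => ?_, fun ι => ?_⟩
  · -- conj-swap compatibility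
    have e : ComplexEmbedding.conjugate (ComplexEmbedding.conjugate ι) = ι := star_star ι
    simp only [Tσ, Multiset.insert_eq_cons, Multiset.map_cons, Multiset.map_singleton]
    congr 1
    · ext <;> simp [ArchWeight.swap, e]
    · congr 1
      ext <;> simp [ArchWeight.swap, e]
  · -- the archimedean parameter of `σ`
    have e : (fun ι : K →+* ℂ => (Tσ ι).map ArchWeight.a) =
        fun ι => (({s₁ ι, s₂ ι} : Multiset ℂ)).map (· + p ι) := by
      funext ι
      rw [hTa ι]
      simp
    rw [e]
    exact hσarch
  · -- C-algebraic: all exponents in `1/2 + ℤ`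
    simp only [Tσ, Multiset.insert_eq_cons, Multiset.mem_cons, Multiset.mem_singleton] at hw
    rcases hw with rfl | rfl
    · refine ⟨mp ι, mp (ComplexEmbedding.conjugate ι), ?_, ?_⟩
      · show s₁ ι + p ι = _
        push_cast
        linear_combination hmp ι
      · show s₁ (ComplexEmbedding.conjugate ι) + p (ComplexEmbedding.conjugate ι) = _
        push_cast
        linear_combination hmp (ComplexEmbedding.conjugate ι)
    · refine ⟨mp ι - ma ι, mp (ComplexEmbedding.conjugate ι) - ma (ComplexEmbedding.conjugate ι), ?_, ?_⟩
      · show s₂ ι + p ι = _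
        push_cast
        linear_combination hmp ι - hma ι
      · show s₂ (ComplexEmbedding.conjugate ι) + p (ComplexEmbedding.conjugate ι) = _
        push_cast
        linear_combination hmp (ComplexEmbedding.conjugate ι) - hma (ComplexEmbedding.conjugate ι)
  · -- regular
    rw [hTa ι, Multiset.insert_eq_cons, Multiset.nodup_cons]
    refine ⟨?_, Multiset.nodup_singleton _⟩
    rw [Multiset.mem_singleton]
    intro h
    exact ha0 ι (by linear_combination h)

/-- **The line concludes the crux, BY NAME** (the audited skeleton theorem): the binder form fed with the six
registered stubs — the `sorry`s live only inside `stub_*`. -/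
theorem RegularTwistCM_of :
    Summit.Langlands.Langlands.Theses.IrreducibilityBySelfDuality.RegularTwistCM :=
  RegularTwistCM_of_stubs stub_adjointArchShadowNonDihedral stub_dihedralVacuity stub_descentInfinityType
    stub_centralCharacterDatum stub_halfIntegralTwist stub_twistRealisation

end Summit.Langlands.Langlands.Cruxes.RegularTwistCM.PeterssonHermitianPurity

end
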